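import Summits.CriticalPhenomena.Ising3DConformalLimit.Theses.FKParityRobustness
import Summits.CriticalPhenomena.Ising3DConformalLimit.Theorems.FKParityRobustnessDefs
import HarnessLib

/-!
# Crux `IndependentStrandsJoin` (stmt-CriticalPhenomena-14625) — idea `xor-switching-sandwich`
# crux-plan verdict: NO SKELETON.  This file: the XOR-switching DICTIONARY (checked statements + glue)

Route `FKParityRobustness`, sub-problem `Ising3DConformalLimit`; crux-plan seat
`planner-cruxplan-stmt-CriticalPhenomena-14625-xor-switching-sandwi-0`, 2026-08-16.
Companion of the line card `Cruxes/IndependentStrandsJoin/Lines/xor-switching-sandwich.md`.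

NO `stub_*` is registered here and NO `IndependentStrandsJoin_of` is offered: every concluding skeleton the
XOR-switching lever supports has exactly ONE open stub, the lattice clause (iii) at tetrahedra
`TetraU4Lattice`, which is (a) the idea card's own transfer target `C⁺ = TetraU4Box`, (b) verbatim the open
stub `stub_tetraU4Lattice` of the picked line `Lines/Sketch.lean` (tetrahedral sandwich), and (c) by the
landed theorems `Theorems.stub_transfer` (p89664, `TetraU4Lattice(c) ⇒ crux(c/3)`) and
`Theorems.stub_converse` (p92514, `crux(c) ⇒ TetraU4Lattice(2c)`) PROVABLY EQUIVALENT to the crux — a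
one-stub costume and a duplicate of the picked line.  See the line card for the alternatives tried
(`UnionJoin`, the `s`-split, the infinite-volume dress) and why none is a different line.

What the lever DOES give is recorded below as elaborated statements over the tree vocabulary
(`tJoins`, `loopO1PartitionFunction`, `connectedFour`, `isingMeasure`, `isingCorr` — nothing new is defined in
the tree; the local `def`s `joinSum`, `noJoinSum`, `allConnSum`, `sepNoBridgeSum` are abbreviations of the
finite sums, unfold them to land a statement as a `--supports stmt-CriticalPhenomena-14625` theorem):

* `NoJoinSwitch` — the card's EXACT T-join XOR-switching identity for one pairing (ideator 1; verified by
  exact enumeration by the ideator, both triagers and this seat): `noJoinSum(01|23) = sepNoBridgeSum(01|23)`.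
* `PairingSumIdentity` — NEW here (pairing-summed form, NO symmetry needed, every finite graph, every real
  `t`): `Σ_π noJoinSum_π = Z⁰·Z^A − allConnSum`, because the three "separated-and-unbridged" classes
  partition the complement of "all four sources connected in `F⁰ ∪ F'`".
* `UrsellLoopIdentity` — NEW, its spin form via the high-temperature expansion: on every finite graph,
  `β ≥ 0`, `t = tanh β`, four distinct vertices,
      `U₄(a) · (Z⁰)² = allConnSum − (joinSum(01|23) + joinSum(02|13) + joinSum(03|12))`,
  i.e. `−U₄ = Σ_π ⟨σ_{π₁}⟩⟨σ_{π₂}⟩ · q_π − ⟨σ_A⟩ · s` with `q_π = ℓ^{π₁}⊗ℓ^{π₂}[the two pairs joined]` and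
  `s = ℓ^∅⊗ℓ^A[all four joined]` — the odd-part (loop-O(1)) analogue of Aizenman's
  `−U₄ = 2⟨σ_{π₁}⟩⟨σ_{π₂}⟩ · P^{π₁}⊗P^{π₂}[joined in n₁+n₂]`.  Checked numerically with SPIN-side `U₄`
  (brute force) on `Q₃`+tetrahedron (`t_c`, `β = 0.55`), `K₄` (`β = 0.4`) and four asymmetric random 7-vertex
  graphs: relative error `≤ 2·10⁻¹⁴` (folder `toy/ursell_loop_check.py`).
* `XorUpperSandwich` — corollary `|U₄|·(Z⁰)² ≤ Σ_π joinSum_π` (graph-uniform; `allConnSum ≥ 0`), PROVED here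
  from `UrsellLoopIdentity` (`xorUpperSandwich_of_identity`).  With `StrandsJoinBound` (item 14647, proved:
  `2·joinSum_π ≤ |U₄|(Z⁰)²` for each `π`) this brackets `|U₄|(Z⁰)²` between `2·max_π joinSum_π` and
  `Σ_π joinSum_π` on EVERY graph.
* `JoinSumSymmetry` (provable now, transport along the two automorphisms of the landed `stub_symmetry`) and
  the glue `symmetricXorSandwich_of`, `boxXorSandwich_of` (PROVED here): under the tetrahedral pairing
  symmetry `|U₄|(Z⁰)² ≤ 3·joinSum(01|23)` — the card's `TetraSandwich`, i.e. `q ≥ (2/3)·m`.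
* `SFormIdentity` — the card's exact `s`-form `1 − q = (1 − 2m/3)(1 − s)` in cleared denominators.
* `XorTransfer` — `TetraU4Lattice → IndependentStrandsJoin` through the XOR sandwich (the card's
  `JoinFromU4Box`; same content as the LANDED `Theorems.stub_transfer`, which goes through `meetSum` instead).
* `UnionJoin` — the only candidate for a DIFFERENT hard stub (`s ≥ c`: a 4-source configuration plus ONE
  independent vacuum soup is all-joined), recorded with the verdict NOT RECOMMENDED: strictly stronger than the
  crux (`q ≥ 3s/(1+2s)`) with no why-easier (line card §2).

Disproof used (`Cruxes/IndependentStrandsJoin/Disproof.lean`, cdisprove cycle 1): § A (only the `l`-uniform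
constant is content) — every identity here is graph-uniform and claimed only as an identity; § A′
(`not_graphUniformStrandsJoin`, landed `Negative/GraphUniform.lean`) — no graph-uniform lower bound is claimed
(on the path `0–1–2–3` both sides of `NoJoinSwitch` are `c`-free equalities and `UnionJoin`/`XorTransfer` are box
statements); § B (`stub_tetraU4Lattice ⟺ crux`) — is exactly the reason for the no-skeleton verdict.

References: M. Aizenman, Comm. Math. Phys. 86 (1982) 1–48, Prop. 5.3 [AizenmanCMP1982]; M. Aizenman,
H. Duminil-Copin, Ann. of Math. 194 (2021), arXiv:1912.07973, eq. (3.11) [AizenmanDuminilCopinAnnals2021];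
U. T. Hansen, J. Jiang, F. R. Klausen, arXiv:2506.10765, §2 (switching principle for even subgraphs)
[HansenJiangKlausen2025]; G. Grimmett, S. Janson, arXiv:0709.3039 [GrimmettJanson2007].
-/

noncomputable section

open Finset SimpleGraph
open Literature.Probability.LatticeModels
open Summit.CriticalPhenomena.Ising3DConformalLimit.Theses.FKParityRobustness
open Summit.CriticalPhenomena.Ising3DConformalLimit.Cruxes.ParityRobustMerging.PlaquetteXorSurgery
  (tetra tetra_injective tanh_criticalBeta_nonneg)

namespace Summit.CriticalPhenomena.Ising3DConformalLimit.Cruxes.IndependentStrandsJoin.XorSwitching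

open scoped Classical BigOperators

/-! ### § 0. The finite sums (abbreviations; general finite graph, any real weight `t`) -/

section General

variable {V : Type*} [Fintype V] [DecidableEq V] (G : SimpleGraph V) [DecidableRel G.Adj]

/-- `joinSum t x y z w = Σ_{F₁ ∈ 𝒯(xy)} Σ_{F₂ ∈ 𝒯(zw)} t^{|F₁|+|F₂|} 1[x ↔ z in F₁ ∪ F₂]`: the crux's double
sum for the pairing `(x y | z w)` (for a `T`-join of a pair joins its pair, so `x ↔ z` in the union is "all
four in one component", `Disproof.reachable_cross_iff_joinsAll`). -/
def joinSum (t : ℝ) (x y z w : V) : ℝ :=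
  ∑ F₁ ∈ tJoins G Set.univ ({x, y} : Finset V), ∑ F₂ ∈ tJoins G Set.univ ({z, w} : Finset V),
    if (SimpleGraph.fromEdgeSet ((↑F₁ : Set (Sym2 V)) ∪ ↑F₂)).Reachable x z
    then t ^ (F₁.card + F₂.card) else 0

/-- `noJoinSum t x y z w`: the complementary double sum (`1[x ↮ z in F₁ ∪ F₂]`), so that
`joinSum + noJoinSum = Z^{xy} · Z^{zw}`. -/
def noJoinSum (t : ℝ) (x y z w : V) : ℝ :=
  ∑ F₁ ∈ tJoins G Set.univ ({x, y} : Finset V), ∑ F₂ ∈ tJoins G Set.univ ({z, w} : Finset V),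
    if (SimpleGraph.fromEdgeSet ((↑F₁ : Set (Sym2 V)) ∪ ↑F₂)).Reachable x z
    then 0 else t ^ (F₁.card + F₂.card)

/-- `allConnSum t a = Σ_{F⁰ ∈ 𝒯(∅)} Σ_{F' ∈ 𝒯(A)} t^{|F⁰|+|F'|} 1[a₀, a₁, a₂, a₃ all connected in F⁰ ∪ F']`
(`A = {a i}`): the VACUUM ⊗ FOUR-SOURCE all-joined weight (`s · Z⁰ Z^A`). -/
def allConnSum (t : ℝ) (a : Fin 4 → V) : ℝ :=
  ∑ F₀ ∈ tJoins G Set.univ (∅ : Finset V), ∑ F' ∈ tJoins G Set.univ (Finset.univ.image a),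
    if ∀ i : Fin 4, (SimpleGraph.fromEdgeSet ((↑F₀ : Set (Sym2 V)) ∪ ↑F')).Reachable (a 0) (a i)
    then t ^ (F₀.card + F'.card) else 0

/-- `sepNoBridgeSum t a`: vacuum ⊗ four-source weight of "`F'` pairs `(a₀a₁)(a₂a₃)` SEPARATELY and the
vacuum configuration does not bridge the two pairs" — the right-hand side of `NoJoinSwitch`. -/
def sepNoBridgeSum (t : ℝ) (a : Fin 4 → V) : ℝ :=
  ∑ F₀ ∈ tJoins G Set.univ (∅ : Finset V), ∑ F' ∈ tJoins G Set.univ (Finset.univ.image a),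
    if (SimpleGraph.fromEdgeSet (↑F' : Set (Sym2 V))).Reachable (a 0) (a 1)
        ∧ ¬ (SimpleGraph.fromEdgeSet (↑F' : Set (Sym2 V))).Reachable (a 0) (a 2)
        ∧ ¬ (SimpleGraph.fromEdgeSet ((↑F₀ : Set (Sym2 V)) ∪ ↑F')).Reachable (a 0) (a 2)
    then t ^ (F₀.card + F'.card) else 0

/-- The join sum is nonnegative for `t ≥ 0`. -/
theorem joinSum_nonneg {t : ℝ} (ht : 0 ≤ t) (x y z w : V) : 0 ≤ joinSum G t x y z w := by
  unfold joinSum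
  refine Finset.sum_nonneg fun F₁ _ => Finset.sum_nonneg fun F₂ _ => ?_
  split_ifs
  · exact pow_nonneg ht _
  · exact le_rfl

/-- The all-connected vacuum weight is nonnegative for `t ≥ 0`. -/
theorem allConnSum_nonneg {t : ℝ} (ht : 0 ≤ t) (a : Fin 4 → V) : 0 ≤ allConnSum G t a := by
  unfold allConnSum
  refine Finset.sum_nonneg fun F₀ _ => Finset.sum_nonneg fun F' _ => ?_
  split_ifs
  · exact pow_nonneg ht _
  · exact le_rfl

end General

/-- `0 ≤ tanh β` for `β ≥ 0` (folklore; two lines, kept local). -/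
theorem tanh_nonneg {β : ℝ} (hβ : 0 ≤ β) : 0 ≤ Real.tanh β := by
  rw [Real.tanh_eq_sinh_div_cosh]
  exact div_nonneg (Real.sinh_nonneg_iff.2 hβ) (Real.cosh_pos _).le

/-! ### § 1. The exact identities (statements; provable now, finite combinatorics) -/

/-- **`NoJoinSwitch` (the card's lever; ideator 1, `SketchIdeator1.NoJoinSwitch` with the source set written
`univ.image a`).**  On every finite graph, every real `t`, four distinct vertices:
`noJoinSum(01|23) = sepNoBridgeSum(01|23)`.  Proof: `(F₁, F₂) ↦ (H, I) = (F₁ ∆ F₂, F₁ ∩ F₂)` preserves the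
weight `t^{|H|+2|I|}` and the UNION `F₁ ∪ F₂ = H ∪ I`; the fibre over `(H, I)` for sources `(S₁, S₂)` is the
affine space `{H₁ ⊆ H : ∂H₁ = S₁ ∆ ∂I}` (a coset of the cycle space of `H`, size `2^{b₁(H)}` when non-empty);
for `S₁ = {a₀,a₁}` versus `S₁ = ∅` both are non-empty iff `a₀ ~_H a₁`, and on `{a₀ ≁_H a₁}` the left event is
empty (parity puts `a₂` or `a₃` in the `H`-component of `a₀`, and a `T`-join of a pair joins its pair).
Size M (𝔽₂-linear algebra over `tJoins`; `Literature.Combinatorics.SimpleGraph.CycleSpaceSeparators`). -/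
def NoJoinSwitch : Prop :=
  ∀ (V : Type) [Fintype V] [DecidableEq V] (G : SimpleGraph V) [DecidableRel G.Adj] (t : ℝ)
    (a : Fin 4 → V), Function.Injective a →
    noJoinSum G t (a 0) (a 1) (a 2) (a 3) = sepNoBridgeSum G t a

/-- **`PairingSumIdentity` (NEW, pairing-summed XOR switching; no symmetry).**  On every finite graph, every
real `t`, four distinct vertices:
`noJoinSum(01|23) + noJoinSum(02|13) + noJoinSum(03|12) = Z⁰ · Z^A − allConnSum`.
Proof: apply `NoJoinSwitch` to the three pairings (relabel `a`); the three "separated-and-unbridged"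
events are pairwise disjoint and their union is the complement, inside `𝒯(∅) × 𝒯(A)`, of "all four sources
connected in `F⁰ ∪ F'`" (if `F'` joins all four there is nothing to separate; if `F'` pairs `π` separately,
either the vacuum bridges the two pairs — all connected — or the `π`-event holds).  Size S given
`NoJoinSwitch`. -/
def PairingSumIdentity : Prop :=
  ∀ (V : Type) [Fintype V] [DecidableEq V] (G : SimpleGraph V) [DecidableRel G.Adj] (t : ℝ)
    (a : Fin 4 → V), Function.Injective a →
    noJoinSum G t (a 0) (a 1) (a 2) (a 3) + noJoinSum G t (a 0) (a 2) (a 1) (a 3)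
        + noJoinSum G t (a 0) (a 3) (a 1) (a 2)
      = loopO1PartitionFunction G t ∅ * loopO1PartitionFunction G t (Finset.univ.image a)
        - allConnSum G t a

/-- **`UrsellLoopIdentity` (NEW; the loop-O(1) representation of the Ursell function).**  On every finite
graph, `β ≥ 0`, `t = tanh β`, four distinct vertices:
`U₄(a) · (Z⁰)² = allConnSum − (joinSum(01|23) + joinSum(02|13) + joinSum(03|12))`,
i.e. `−U₄ = Σ_π ⟨σ_{π₁}⟩⟨σ_{π₂}⟩ q_π − ⟨σ_A⟩ s`.  Proof: `PairingSumIdentity`, `joinSum_π + noJoinSum_π =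
Z^{π₁} Z^{π₂}`, and the high-temperature expansions `⟨σ_B⟩^free · Z⁰ = Z^B` (`isingCorr_free_eq_hteSum_div`,
`DepletionBound.loopO1PartitionFunction_eq_hteSum`) which give `U₄ (Z⁰)² = Z^A Z⁰ − Σ_π Z^{π₁}Z^{π₂}` (the
preamble of the landed `Theorems.StubTransfer.joint_ge_of_sep_sym_u4`).  Verified numerically against
brute-force spins on 7 graphs (header).  Size M. -/
def UrsellLoopIdentity : Prop :=
  ∀ (V : Type) [Fintype V] [DecidableEq V] (G : SimpleGraph V) [DecidableRel G.Adj] (β : ℝ), 0 ≤ β →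
    ∀ a : Fin 4 → V, Function.Injective a →
    connectedFour (isingMeasure G Finset.univ β 0 .free) spinAt a
        * (loopO1PartitionFunction G (Real.tanh β) ∅) ^ 2
      = allConnSum G (Real.tanh β) a
        - (joinSum G (Real.tanh β) (a 0) (a 1) (a 2) (a 3) + joinSum G (Real.tanh β) (a 0) (a 2) (a 1) (a 3)
            + joinSum G (Real.tanh β) (a 0) (a 3) (a 1) (a 2))

/-- **`SFormIdentity` (the card's exact `s`-form, cleared denominators).**  If `(G, a)` carries the two
automorphisms of the tetrahedral pairing symmetry (fixing `a₀`, realising `(a₁a₂)` and `(a₁a₃)`), then for every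
real `t`:  `3 · noJoinSum(01|23) = Z⁰ · Z^A − allConnSum`, i.e. `1 − q = (S₄/3τ²)(1 − s) = (1 − 2m/3)(1 − s)`.
Proof: `PairingSumIdentity` + transport of `noJoinSum` along the automorphisms. -/
def SFormIdentity : Prop :=
  ∀ (V : Type) [Fintype V] [DecidableEq V] (G : SimpleGraph V) [DecidableRel G.Adj] (t : ℝ)
    (a : Fin 4 → V), Function.Injective a →
    (∃ φ : G ≃g G, φ (a 0) = a 0 ∧ φ (a 1) = a 2 ∧ φ (a 2) = a 1 ∧ φ (a 3) = a 3) →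
    (∃ ψ : G ≃g G, ψ (a 0) = a 0 ∧ ψ (a 1) = a 3 ∧ ψ (a 3) = a 1 ∧ ψ (a 2) = a 2) →
    3 * noJoinSum G t (a 0) (a 1) (a 2) (a 3)
      = loopO1PartitionFunction G t ∅ * loopO1PartitionFunction G t (Finset.univ.image a)
        - allConnSum G t a

/-! ### § 2. The sandwich (statements + checked glue) -/

/-- **`XorUpperSandwich`** (graph-uniform UPPER bound on `|U₄|` by loop joinings): on every finite graph,
`β ≥ 0`, four distinct vertices, `−U₄(a) · (Z⁰)² ≤ joinSum(01|23) + joinSum(02|13) + joinSum(03|12)`.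
Immediate from `UrsellLoopIdentity` and `allConnSum ≥ 0` (`xorUpperSandwich_of_identity`). -/
def XorUpperSandwich : Prop :=
  ∀ (V : Type) [Fintype V] [DecidableEq V] (G : SimpleGraph V) [DecidableRel G.Adj] (β : ℝ), 0 ≤ β →
    ∀ a : Fin 4 → V, Function.Injective a →
    -(connectedFour (isingMeasure G Finset.univ β 0 .free) spinAt a
        * (loopO1PartitionFunction G (Real.tanh β) ∅) ^ 2)
      ≤ joinSum G (Real.tanh β) (a 0) (a 1) (a 2) (a 3) + joinSum G (Real.tanh β) (a 0) (a 2) (a 1) (a 3)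
          + joinSum G (Real.tanh β) (a 0) (a 3) (a 1) (a 2)

/-- `UrsellLoopIdentity ⟹ XorUpperSandwich` (drop the nonnegative vacuum term). -/
theorem xorUpperSandwich_of_identity (h : UrsellLoopIdentity) : XorUpperSandwich := by
  intro V _ _ G _ β hβ a ha
  have hid := h V G β hβ a ha
  have hA : 0 ≤ allConnSum G (Real.tanh β) a := allConnSum_nonneg G (tanh_nonneg hβ) a
  linarith [hid, hA]

/-- **`JoinSumSymmetry`** (provable now, size S): automorphisms fixing `a₀` and realising `(a₁a₂)`, resp.
`(a₁a₃)`, transport the `(01|23)` join sum onto the `(02|13)`, resp. `(03|12)`, join sum (transport of `tJoins`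
and of reachability along a graph isomorphism: `Theorems.StubSymmetry.sum_filter_tJoins_transport`,
`reachable_image_sym2Map_iff`, landed p90471; the cross vertex of the join event is immaterial by
`Disproof.reachable_cross_iff_joinsAll`). -/
def JoinSumSymmetry : Prop :=
  ∀ (V : Type) [Fintype V] [DecidableEq V] (G : SimpleGraph V) [DecidableRel G.Adj] (t : ℝ)
    (a : Fin 4 → V), Function.Injective a →
    (∃ φ : G ≃g G, φ (a 0) = a 0 ∧ φ (a 1) = a 2 ∧ φ (a 2) = a 1 ∧ φ (a 3) = a 3) →
    (∃ ψ : G ≃g G, ψ (a 0) = a 0 ∧ ψ (a 1) = a 3 ∧ ψ (a 3) = a 1 ∧ ψ (a 2) = a 2) →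
    joinSum G t (a 0) (a 2) (a 1) (a 3) = joinSum G t (a 0) (a 1) (a 2) (a 3)
      ∧ joinSum G t (a 0) (a 3) (a 1) (a 2) = joinSum G t (a 0) (a 1) (a 2) (a 3)

/-- **`SymmetricXorSandwich`** (the card's `TetraSandwich` on a general graph with the pairing symmetry):
`−U₄(a) · (Z⁰)² ≤ 3 · joinSum(01|23)`, i.e. `q ≥ (2/3) · m` with `m = |U₄|/(2τ₀₁τ₂₃)` (Aizenman's double-current
meeting probability) — "the Bern(`t_c²`) sprinkling of each trace raises the joining probability by a factor
`≤ 3/2`". -/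
def SymmetricXorSandwich : Prop :=
  ∀ (V : Type) [Fintype V] [DecidableEq V] (G : SimpleGraph V) [DecidableRel G.Adj] (β : ℝ), 0 ≤ β →
    ∀ a : Fin 4 → V, Function.Injective a →
    (∃ φ : G ≃g G, φ (a 0) = a 0 ∧ φ (a 1) = a 2 ∧ φ (a 2) = a 1 ∧ φ (a 3) = a 3) →
    (∃ ψ : G ≃g G, ψ (a 0) = a 0 ∧ ψ (a 1) = a 3 ∧ ψ (a 3) = a 1 ∧ ψ (a 2) = a 2) →
    -(connectedFour (isingMeasure G Finset.univ β 0 .free) spinAt a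
        * (loopO1PartitionFunction G (Real.tanh β) ∅) ^ 2)
      ≤ 3 * joinSum G (Real.tanh β) (a 0) (a 1) (a 2) (a 3)

/-- `XorUpperSandwich ∧ JoinSumSymmetry ⟹ SymmetricXorSandwich` (pure arithmetic). -/
theorem symmetricXorSandwich_of (hU : XorUpperSandwich) (hJ : JoinSumSymmetry) :
    SymmetricXorSandwich := by
  intro V _ _ G _ β hβ a ha hφ hψ
  have h1 := hU V G β hβ a ha
  obtain ⟨h2, h3⟩ := hJ V G (Real.tanh β) a ha hφ hψ
  linarith

/-- **`BoxPairingSymmetry`** — verbatim the LANDED `Theorems.stub_boxSymmetry` (p87363): the boxes `Λ_N` with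
`a = l · tetra` carry the two automorphisms (coordinate transpositions `y ↔ z`, `x ↔ z`).  Restated as a `Prop`
only so that this workfile need not import the freshly landed `Theorems` module. -/
def BoxPairingSymmetry : Prop :=
  ∀ (l N : ℕ) (a : Fin 4 → ↥(box 3 N)),
    (∀ i, ((a i : Site 3)) = (l : ℤ) •
      (![![-1, -1, -1], ![1, 1, -1], ![1, -1, 1], ![-1, 1, 1]] : Fin 4 → Site 3) i) →
    (∃ φ : ((zdGraph 3).comap (Subtype.val : ↥(box 3 N) → Site 3)) ≃g
        ((zdGraph 3).comap (Subtype.val : ↥(box 3 N) → Site 3)),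
        φ (a 0) = a 0 ∧ φ (a 1) = a 2 ∧ φ (a 2) = a 1 ∧ φ (a 3) = a 3) ∧
    (∃ ψ : ((zdGraph 3).comap (Subtype.val : ↥(box 3 N) → Site 3)) ≃g
        ((zdGraph 3).comap (Subtype.val : ↥(box 3 N) → Site 3)),
        ψ (a 0) = a 0 ∧ ψ (a 1) = a 3 ∧ ψ (a 3) = a 1 ∧ ψ (a 2) = a 2)

/-- **`BoxXorSandwich`** (= ideator 1's `TetraSandwich`): in every box `Λ_N`, for `a = l · tetra`, `l ≥ 1`, at
`β_c(3)`:  `−U₄^{free}_{Λ_N}(a) · (Z⁰)² ≤ 3 · joinSum(01|23)` — the crux's own double sum on the right. -/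
def BoxXorSandwich : Prop :=
  ∀ (l N : ℕ) (a : Fin 4 → ↥(box 3 N)),
    (∀ i, ((a i : Site 3)) = (l : ℤ) •
      (![![-1, -1, -1], ![1, 1, -1], ![1, -1, 1], ![-1, 1, 1]] : Fin 4 → Site 3) i) → 1 ≤ l →
    -(connectedFour (isingMeasure ((zdGraph 3).comap (Subtype.val : ↥(box 3 N) → Site 3))
          Finset.univ (criticalBeta 3) 0 .free) spinAt a
        * (loopO1PartitionFunction ((zdGraph 3).comap (Subtype.val : ↥(box 3 N) → Site 3))
            (Real.tanh (criticalBeta 3)) ∅) ^ 2)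
      ≤ 3 * joinSum ((zdGraph 3).comap (Subtype.val : ↥(box 3 N) → Site 3))
            (Real.tanh (criticalBeta 3)) (a 0) (a 1) (a 2) (a 3)

/-- `SymmetricXorSandwich ∧ BoxPairingSymmetry ⟹ BoxXorSandwich` (specialise to the box; `a = l · tetra` is
injective for `l ≥ 1`, `tetra_injective`; `β_c ≥ 0`, `criticalBeta_nonneg`). -/
theorem boxXorSandwich_of (h5 : SymmetricXorSandwich) (hbox : BoxPairingSymmetry) : BoxXorSandwich := by
  intro l N a ha hl
  obtain ⟨hφ, hψ⟩ := hbox l N a ha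
  exact h5 (↥(box 3 N)) ((zdGraph 3).comap (Subtype.val : ↥(box 3 N) → Site 3)) (criticalBeta 3)
    (criticalBeta_nonneg 3) a (tetra_injective hl a ha) hφ hψ

/-! ### § 3. The transfer target and the transfer (why there is no second line) -/

/-- **`TetraU4Lattice`** — VERBATIM the open stub `stub_tetraU4Lattice` of `Lines/Sketch.lean` (= the card's
`TetraU4Box` = lattice clause (iii) at regular tetrahedra): PROVABLY EQUIVALENT to the crux
(`Theorems.stub_transfer` p89664: `c ↦ c/3`; `Theorems.stub_converse` p92514: `c ↦ 2c`).  Any XOR-switching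
skeleton would have THIS as its only open stub. -/
def TetraU4Lattice : Prop :=
  ∃ c : ℝ, 0 < c ∧ ∀ l : ℕ, 1 ≤ l → ∃ N₀ : ℕ, ∀ N : ℕ, N₀ ≤ N → ∀ a : Fin 4 → ↥(box 3 N),
    (∀ i, ((a i : Site 3)) = (l : ℤ) •
      (![![-1, -1, -1], ![1, 1, -1], ![1, -1, 1], ![-1, 1, 1]] : Fin 4 → Site 3) i) →
    connectedFour (isingMeasure ((zdGraph 3).comap (Subtype.val : ↥(box 3 N) → Site 3))
        Finset.univ (criticalBeta 3) 0 .free) spinAt a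
      ≤ -(c * isingCorr ((zdGraph 3).comap (Subtype.val : ↥(box 3 N) → Site 3)) Finset.univ
            (criticalBeta 3) 0 .free {a 0, a 1} *
          isingCorr ((zdGraph 3).comap (Subtype.val : ↥(box 3 N) → Site 3)) Finset.univ
            (criticalBeta 3) 0 .free {a 2, a 3})

/-- **`XorTransfer`** (the card's `JoinFromU4Box`; provable now, size S given `BoxXorSandwich` and
`⟨σ_xσ_y⟩^free = Z^{xy}/Z⁰`): `BoxXorSandwich → TetraU4Lattice → IndependentStrandsJoin` with constant `c/3` and
the same `N₀(l)` — `3·joinSum ≥ −U₄ (Z⁰)² ≥ c·⟨σ₀σ₁⟩⟨σ₂σ₃⟩ (Z⁰)² = c·Z^{01}Z^{23}`.  Same conclusion as the LANDED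
`Theorems.stub_transfer` (which bounds the smaller `meetSum`), hence not filed as a stub: it would be the second
proof of an edge already in the tree. -/
def XorTransfer : Prop :=
  BoxXorSandwich → TetraU4Lattice → IndependentStrandsJoin

/-- **`UnionJoin`** (RECORDED, NOT RECOMMENDED).  The only candidate the lever offers for a hard stub that is
not `TetraU4Lattice`: "`s ≥ c`" — a critical 4-source loop configuration on `l · tetra` plus ONE independent
vacuum soup connects all four sources with `ℓ^∅ ⊗ ℓ^A`-probability `≥ c`, uniformly in `l`.  By `SFormIdentity`
and `m ≥ q` it implies the crux (`q ≥ 3s/(1+2s)`), but it is STRICTLY STRONGER (the crux allows `s → 0` with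
`m ≥ c`) and exposes no tool: it asks an independent critical loop soup to bridge two repelling strand-clusters
of ONE configuration (`p_X → 0`, `x₄ > 3`), a loop-soup crossing LOWER bound between random fractal sets in
`d = 3` (same `2D_HT − 3` count as the crux; false for thin deterministic sets, `D_HT + 1 < 3`).  Predicted true
(`s* ≈ 0.2`: MC j014058 `s = 0.12–0.18` at `l ≤ 4`), not easier — a costume transfer by the protocol's rule. -/
def UnionJoin : Prop :=
  ∃ c : ℝ, 0 < c ∧ ∀ l : ℕ, 1 ≤ l → ∃ N₀ : ℕ, ∀ N : ℕ, N₀ ≤ N → ∀ a : Fin 4 → ↥(box 3 N),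
    (∀ i, ((a i : Site 3)) = (l : ℤ) •
      (![![-1, -1, -1], ![1, 1, -1], ![1, -1, 1], ![-1, 1, 1]] : Fin 4 → Site 3) i) →
    c * (loopO1PartitionFunction ((zdGraph 3).comap (Subtype.val : ↥(box 3 N) → Site 3))
            (Real.tanh (criticalBeta 3)) ∅
          * loopO1PartitionFunction ((zdGraph 3).comap (Subtype.val : ↥(box 3 N) → Site 3))
            (Real.tanh (criticalBeta 3)) (Finset.univ.image a))
      ≤ allConnSum ((zdGraph 3).comap (Subtype.val : ↥(box 3 N) → Site 3))
          (Real.tanh (criticalBeta 3)) a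

/-! ### § 4. Consistency checks -/

/-- The transfer target is literally the registered stub's statement (same text as `Lines/Sketch.lean`,
`def TetraU4Lattice`), and the crux is the route decl. -/
example : XorTransfer = (BoxXorSandwich → TetraU4Lattice →
    Summit.CriticalPhenomena.Ising3DConformalLimit.Theses.FKParityRobustness.IndependentStrandsJoin) := rfl

/-- The whole provable half chains: identity ⟹ upper sandwich ⟹ (with symmetry) the box sandwich. -/
theorem boxXorSandwich_of_identity (h : UrsellLoopIdentity) (hJ : JoinSumSymmetry)
    (hbox : BoxPairingSymmetry) : BoxXorSandwich :=
  boxXorSandwich_of (symmetricXorSandwich_of (xorUpperSandwich_of_identity h) hJ) hbox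

end Summit.CriticalPhenomena.Ising3DConformalLimit.Cruxes.IndependentStrandsJoin.XorSwitching

end
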